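import Summits.QuantumFields.BalabanUV.Beta.D1BFx.TorusTraceTadpole

/-!
# `BalabanUV.Beta.D1BFx.TorusTraceBubbleTwoLeg` — road «BF-x» for binder row D1, slot (K), brick **TA3b-BUBBLE₂**: the TWO-LEG twin of
# `TorusTraceTadpole` §2–§7 — the torus bubble of TWO different periodised decaying legs against the periodised arrays of two bi-localised
# vertices IS a `ℤ^D` diagonal image sum (exactly), hence converges to `tr ((A∘V)∘(B∘V′))` along growing tori; plus the identity leg

HONEST DEPENDENCY (cell records, verbatim): «continuum YM on T⁴ ⇐ BetaPertH ∧ nine spine estimates (0/9 proved); BetaPertH ⇐ (D1) ∧ (D4) ∧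
CAP+tail; G-an2-4 gates asym, D1 and NE2/3/4.»  HONEST FRAMING (cell contract, verbatim): «discharging `BetaPertH` makes Bałaban's UV stability
UNCONDITIONAL — a real constructive-QFT result; it is NOT the continuum limit and NOT the Clay problem.»  THIS MODULE DISCHARGES NOTHING of (K),
of D1 or of the wall: [folklore] absolutely convergent lattice bookkeeping over an2's `ExpKernelCalculus` (`comp`, `tr`, `Decays`, `BiLoc`) and
`HessKerSchurResolvent.idK`, an4's `EntrywiseVolumeLimit` (`imageShift`, `imageTail`), the D1 swarm's `FibredPeriodisation` (`periodiseF`, `compF`,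
`kdeltaF`, `periodiseF_compF_matrix`, `periodiseF_kdeltaF_matrix`), brick TA2 `PeriodicArrays` (`arr`, `toF`, `comp_arr_arr`, `decays_arr`, …),
brick TA3a `ArrayTraceLimits` (the two `ℤ^D` image-tail rates) and brick TA3b `TorusTraceTadpole` (`periodiseF_toF_mul_arr`,
`trace_periodiseF_toF_arr`, `tendsto_of_abs_sub_le_imageTail₂`) — all USED BY NAME.  No definition, no `def … : Prop`, nothing cited, 0 sorry.
NOT D1, NOT BetaPertH, NOT continuum, NOT Clay.

ABSOLUTE RULE (cell charter, verbatim): «No internally-minted statement may enter as a cited fact. Every hypothesis is either kernel-proved in this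
package or a verbatim quotation of a PUBLISHED theorem with page reference. The manuscript(s) under audit are NOT citable for their own disputed
steps — they are the thing under adjudication; programme-internal (2001/route/tribunal) claims are never citable.»

WHERE THIS SITS (`HOME/b2b-balaban-beta-d1-p2/DICT-CHAIN-SPEC.md` v1.2 §1 (S-GH) ∕ §7 «GH-DICT»; owner ruling ρ-g15-1).  `GhostSqrtLeg.hessT_Chat_biLaplacian_split`
(leaf-04 g16, p307400) writes the per-torus bi-Laplacian ghost functional of route T as `2·hessT (Ĝ′; (m+1)²•jets)` MINUS sixteen named `P̂`-words; GH-DICT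
PART 2b reads each word in `ℤ⁴` along `p → ∞`.  The four tadpole words and the main term go by TA3b's one-leg sockets with composite legs
(`KGhostLeg.periodiseF_toF_comp`); the twelve BUBBLE words carry TWO DIFFERENT legs (among `Ĝ′`, `P̂Ĝ′`, `Ĝ′P̂`, `Ĝ′P̂Ĝ′`, `Ĝ′Ĝ′`, `P̂` — every one
the periodisation of a decaying jointly-periodic `ℤ⁴` kernel) and the `V·V′` tadpole-shaped words are bubbles whose second leg is the IDENTITY —
for these TA3b's `tendsto_trace_bubble` (one leg `A` on both factors) does not apply.  THIS FILE is the missing socket: §1 the product and the unfolding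
for legs `A ≠ B`; §2 the socket and the `s`-free rate; §3 the limit `tendsto_trace_bubble₂` (+ the two-rate wrapper); §4 the identity leg `idK`
(`toF idK = kdeltaF`, `(idK)^ = 1`, `Decays idK 1 δ`, joint periodicity) and the corollary `tendsto_trace_arr_arr`:
`tr_T(Â·(arr V)^·(arr V′)^) → tr ((A∘V)∘V′)`.  At `B := A` §3 is TA3b's `tendsto_trace_bubble` (`bubble A V V′ = tr ((A∘V)∘(A∘V′))` by `rfl`).
VOCABULARY: the limit `tr (comp (comp A V) (comp B V′))` IS `PackedKernelSplit.biBubble A V B V′` by `rfl` (not imported here, to keep TA3b's import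
closure); its `(5.10)`-decay ∕ `AbsMoment₂` in the separation variable are `PackedKernelSplitBounds.decay510_biBubbleWord` ∕ `RestKernelWords.absMoment₂_crossWord`
— so the RK-GH rows of the words produced by GH-DICT PART 2b need no new moment socket.
Provenance: β sub-cell, unit `b2b-balaban-beta-d1-p2` gen 15 (road «BF-x» OWNER), 2026-08-21, brick «TA3b-BUBBLE₂» for GH-DICT PART 2b (leaf-04 lineage);
no existing file touched.
-/

noncomputable section

namespace Summit.QuantumFields.BalabanUV.Beta.D1BFx.TorusTraceBubbleTwoLeg

open Filter Topology
open scoped BigOperators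
open Literature.MathematicalPhysics.QuantumFieldTheory.Balaban1983to89
open Literature.MathematicalPhysics.QuantumFieldTheory.Balaban1983to89.Beta
open B12Sec2to5 (l1 l1_nonneg)
open ExpKernelCalculus (Site MKer Decays BiLoc comp tr Zl biLoc_comp_decays)
open HessKerSchurResolvent (idK idK_apply comp_idK_left)
open Summit.QuantumFields.BalabanUV.Beta.TameKernelCalculus (trK trK_comp decays_trK biLoc_trK decays_of_le biLoc_of_le)
open Summit.QuantumFields.BalabanUV.Beta.D1BFx.FibredPeriodisation (Kfib kdeltaF compF periodiseF periodiseF_compF_matrix periodiseF_kdeltaF_matrix)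
open Summit.QuantumFields.BalabanUV.Beta.D1BFx.PeriodicArrays (arr toF toF_apply isPeriodic₂_arr rowBound_arr summable_abs_row_arr decays_arr bdd_arr
  comp_arr_arr)
open Summit.QuantumFields.BalabanUV.Beta.D1BFx.ArrayTraceLimits (abs_sum_diagImages_sub_tr_le abs_tr_comp_arr_sub_le)
open Summit.QuantumFields.BalabanUV.Beta.D1BFx.TorusTraceTadpole (summable_mul_of_decays_bdd toF_comp periodiseF_toF_mul_arr trace_periodiseF_toF_arr
  tendsto_of_abs_sub_le_imageTail₂)

variable {D : ℕ} {F : Type*} [Fintype F]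

/-! ## §1 The two-leg bubble product on the torus and its unfolding as a `ℤ^D` diagonal image sum -/

section Products

variable {s : ℕ} [NeZero s] {A B V V' : MKer D F} {p q p' q' : Site D} {CA CB δA Cv Cv' δ : ℝ}

/-- [folklore] **TWO-LEG BUBBLE PRODUCT ON THE TORUS**: `(Â·(arr s V)^)·(B̂·(arr s V′)^) = (arr s ((A ∘ V) ∘ arr s (B ∘ V′)))^` for two decaying
jointly-`s`-periodic legs `A`, `B` (common rate `δA`; a caller with two rates weakens by `decays_of_le`) — `X := A ∘ V` bi-localised at `(p, p′)`,
`Y := B ∘ V′` at `(q′, q)` (TA3b's `periodiseF_toF_mul_arr` on each factor, TA2's `comp_arr_arr`). -/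
theorem periodiseF_toF_bubble₂ (hA : Decays A CA δA) (hB : Decays B CB δA) (hδA : 0 < δA)
    (hAper : ∀ x y t, ∀ a b : F, A (imageShift s x t) (imageShift s y t) a b = A x y a b)
    (hBper : ∀ x y t, ∀ a b : F, B (imageShift s x t) (imageShift s y t) a b = B x y a b)
    (hV : BiLoc V p p' Cv δ) (hV' : BiLoc V' q' q Cv' δ) (hδ : 0 < δ) :
    Matrix.of (periodiseF s (toF A)) * Matrix.of (periodiseF s (toF (arr s V))) *
        (Matrix.of (periodiseF s (toF B)) * Matrix.of (periodiseF s (toF (arr s V')))) =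
      Matrix.of (periodiseF s (toF (arr s (comp (comp A V) (arr s (comp B V')))))) := by
  set δ₀ : ℝ := min δA δ with hδ₀
  have hδ₀pos : 0 < δ₀ := lt_min hδA hδ
  have hA₀ : Decays A (|CA|) δ₀ := decays_of_le hA (min_le_left _ _)
  have hB₀ : Decays B (|CB|) δ₀ := decays_of_le hB (min_le_left _ _)
  have hV₀ : BiLoc V p p' (|Cv|) δ₀ := biLoc_of_le hV (min_le_right _ _)
  have hV'₀ : BiLoc V' q' q (|Cv'|) δ₀ := biLoc_of_le hV' (min_le_right _ _)
  have hX := biLoc_comp_decays hA₀ hV₀ (half_pos hδ₀pos).le (half_lt_self hδ₀pos)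
  have hY := biLoc_comp_decays hB₀ hV'₀ (half_pos hδ₀pos).le (half_lt_self hδ₀pos)
  rw [periodiseF_toF_mul_arr hA hδA hAper hV hδ, periodiseF_toF_mul_arr hB hδA hBper hV' hδ,
    ← comp_arr_arr hX (half_pos hδ₀pos) hY (half_pos hδ₀pos),
    ← toF_comp (fun x z a b f => summable_mul_of_decays_bdd (decays_arr hX (half_pos hδ₀pos) s) (half_pos (half_pos hδ₀pos))
      (bdd_arr hY (half_pos hδ₀pos) s) x z a b f),
    periodiseF_compF_matrix (summable_abs_row_arr hX (half_pos hδ₀pos) s) (isPeriodic₂_arr s _) (rowBound_arr hY (half_pos hδ₀pos) s)]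

/-- [folklore] **TWO-LEG BUBBLE UNFOLDING**: `tr_T((Â·(arr V)^)·(B̂·(arr V′)^)) = Σ_a Σ'_x Σ'_m ((A∘V) ∘ arr s (B∘V′)) x (x + s·m) a a`, the kernel
`(A∘V) ∘ arr s (B∘V′)` being bi-localised at `(p, p′)` UNIFORMLY in `s`. -/
theorem trace_bubble₂_unfold (hA : Decays A CA δA) (hB : Decays B CB δA) (hδA : 0 < δA)
    (hAper : ∀ x y t, ∀ a b : F, A (imageShift s x t) (imageShift s y t) a b = A x y a b)
    (hBper : ∀ x y t, ∀ a b : F, B (imageShift s x t) (imageShift s y t) a b = B x y a b)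
    (hV : BiLoc V p p' Cv δ) (hV' : BiLoc V' q' q Cv' δ) (hδ : 0 < δ) :
    Matrix.trace (Matrix.of (periodiseF s (toF A)) * Matrix.of (periodiseF s (toF (arr s V))) *
        (Matrix.of (periodiseF s (toF B)) * Matrix.of (periodiseF s (toF (arr s V'))))) =
      ∑ a, ∑' x : Site D, ∑' m : Site D, comp (comp A V) (arr s (comp B V')) x (imageShift s x m) a a := by
  set δ₀ : ℝ := min δA δ with hδ₀
  have hδ₀pos : 0 < δ₀ := lt_min hδA hδ
  have hA₀ : Decays A (|CA|) δ₀ := decays_of_le hA (min_le_left _ _)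
  have hB₀ : Decays B (|CB|) δ₀ := decays_of_le hB (min_le_left _ _)
  have hX := biLoc_comp_decays hA₀ (biLoc_of_le hV (min_le_right _ _) : BiLoc V p p' (|Cv|) δ₀) (half_pos hδ₀pos).le
    (half_lt_self hδ₀pos)
  have hY := biLoc_comp_decays hB₀ (biLoc_of_le hV' (min_le_right _ _) : BiLoc V' q' q (|Cv'|) δ₀) (half_pos hδ₀pos).le
    (half_lt_self hδ₀pos)
  -- `X ∘ arr Y` is bi-localised at `(p, p′)`: transpose, `decays ∘ biLoc`, transpose back
  have hδ₄ : 0 < δ₀ / 2 / 2 := half_pos (half_pos hδ₀pos)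
  have h1 := biLoc_comp_decays (decays_trK (decays_arr hY (half_pos hδ₀pos) s))
    (biLoc_of_le (biLoc_trK hX) (half_le_self (half_pos hδ₀pos).le)) (half_pos hδ₄).le (half_lt_self hδ₄)
  have hXY := biLoc_trK h1
  rw [← trK_comp, show trK (trK (comp (comp A V) (arr s (comp B V')))) = comp (comp A V) (arr s (comp B V')) from rfl] at hXY
  rw [periodiseF_toF_bubble₂ hA hB hδA hAper hBper hV hV' hδ, trace_periodiseF_toF_arr hXY (half_pos hδ₄)]

end Products

/-! ## §2 The socket and the `s`-free rate -/

section Rates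

variable {s : ℕ} [NeZero s] {A B V V' : MKer D F} {p q p' q' : Site D} {CA CB δA Cv Cv' δ : ℝ}

/-- [folklore] **TWO-LEG BUBBLE SOCKET**: the diagonal image tail of `X ∘ arr Y` and the array-versus-centre tail of `tr (X ∘ arr Y) − tr (X ∘ Y)`,
`X = A∘V`, `Y = B∘V′`, add up to a bound for `|tr_T((Â(arr V)^)(B̂(arr V′)^)) − tr ((A∘V) ∘ (B∘V′))|`. -/
theorem abs_trace_bubble₂_sub_le_of (hA : Decays A CA δA) (hB : Decays B CB δA) (hδA : 0 < δA)
    (hAper : ∀ x y t, ∀ a b : F, A (imageShift s x t) (imageShift s y t) a b = A x y a b)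
    (hBper : ∀ x y t, ∀ a b : F, B (imageShift s x t) (imageShift s y t) a b = B x y a b)
    (hV : BiLoc V p p' Cv δ) (hV' : BiLoc V' q' q Cv' δ) (hδ : 0 < δ) {R₁ R₂ : ℝ}
    (h₁ : |(∑ a, ∑' x : Site D, ∑' m : Site D, comp (comp A V) (arr s (comp B V')) x (imageShift s x m) a a) -
        tr (comp (comp A V) (arr s (comp B V')))| ≤ R₁)
    (h₂ : |tr (comp (comp A V) (arr s (comp B V'))) - tr (comp (comp A V) (comp B V'))| ≤ R₂) :
    |Matrix.trace (Matrix.of (periodiseF s (toF A)) * Matrix.of (periodiseF s (toF (arr s V))) *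
        (Matrix.of (periodiseF s (toF B)) * Matrix.of (periodiseF s (toF (arr s V'))))) - tr (comp (comp A V) (comp B V'))| ≤ R₁ + R₂ := by
  rw [trace_bubble₂_unfold hA hB hδA hAper hBper hV hV' hδ]
  calc _ = |((∑ a, ∑' x : Site D, ∑' m : Site D, comp (comp A V) (arr s (comp B V')) x (imageShift s x m) a a) -
            tr (comp (comp A V) (arr s (comp B V')))) +
          (tr (comp (comp A V) (arr s (comp B V'))) - tr (comp (comp A V) (comp B V')))| := by ring_nf
    _ ≤ _ := (abs_add_le _ _).trans (add_le_add h₁ h₂)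

/-- [folklore] **TWO-LEG BUBBLE RATE**: `|tr_T((Â(arr V)^)(B̂(arr V′)^)) − tr ((A∘V)∘(B∘V′))| ≤ R₁(s) + R₂(s)`, `R₁` = TA3a (A1) at the `s`-uniformly
bi-localised kernel `(A∘V) ∘ arr s (B∘V′)` (rate `δ₀∕16`), `R₂` = TA3a (A2) at `(L, Y) := (A∘V, B∘V′)` (rate `δ₀∕4`), `δ₀ = min δA δ`; all constants `s`-free
(TA3b's one-leg constants with the leg constant of the SECOND factor read `|CB|`). -/
theorem abs_trace_bubble₂_sub_le (hA : Decays A CA δA) (hB : Decays B CB δA) (hδA : 0 < δA)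
    (hAper : ∀ x y t, ∀ a b : F, A (imageShift s x t) (imageShift s y t) a b = A x y a b)
    (hBper : ∀ x y t, ∀ a b : F, B (imageShift s x t) (imageShift s y t) a b = B x y a b)
    (hV : BiLoc V p p' Cv δ) (hV' : BiLoc V' q' q Cv' δ) (hδ : 0 < δ) :
    |Matrix.trace (Matrix.of (periodiseF s (toF A)) * Matrix.of (periodiseF s (toF (arr s V))) *
        (Matrix.of (periodiseF s (toF B)) * Matrix.of (periodiseF s (toF (arr s V'))))) - tr (comp (comp A V) (comp B V'))| ≤
      (Fintype.card F : ℝ) *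
          ((Fintype.card F : ℝ) *
              ((((Fintype.card F : ℝ) * (|CB| * |Cv'|) * Zl D (min δA δ - min δA δ / 2)) * Zl D (min δA δ / 2 / 2) *
                  Real.exp (min δA δ / 2 / 2 * l1 (q' - q))) *
                |(Fintype.card F : ℝ) * (|CA| * |Cv|) * Zl D (min δA δ - min δA δ / 2)|) *
            Zl D (min δA δ / 2 / 2 - min δA δ / 2 / 2 / 2)) *
          Zl D (min δA δ / 2 / 2 / 2 / 2) * Real.exp (min δA δ / 2 / 2 / 2 / 2 * l1 (p - p')) *
          imageTail D (min δA δ / 2 / 2 / 2 / 2 * s) +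
        (Fintype.card F : ℝ) ^ 2 *
          (((Fintype.card F : ℝ) * (|CA| * |Cv|) * Zl D (min δA δ - min δA δ / 2)) *
            ((Fintype.card F : ℝ) * (|CB| * |Cv'|) * Zl D (min δA δ - min δA δ / 2))) *
          Zl D (min δA δ / 2 / 2) ^ 2 * Real.exp (min δA δ / 2 / 2 * l1 (p' - q')) * imageTail D (min δA δ / 2 / 2 * s) := by
  have hδ₀pos : 0 < min δA δ := lt_min hδA hδ
  have hA₀ : Decays A (|CA|) (min δA δ) := decays_of_le hA (min_le_left _ _)
  have hB₀ : Decays B (|CB|) (min δA δ) := decays_of_le hB (min_le_left _ _)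
  have hX := biLoc_comp_decays hA₀ (biLoc_of_le hV (min_le_right _ _) : BiLoc V p p' (|Cv|) (min δA δ)) (half_pos hδ₀pos).le
    (half_lt_self hδ₀pos)
  have hY := biLoc_comp_decays hB₀ (biLoc_of_le hV' (min_le_right _ _) : BiLoc V' q' q (|Cv'|) (min δA δ)) (half_pos hδ₀pos).le
    (half_lt_self hδ₀pos)
  have hδ₄ : 0 < min δA δ / 2 / 2 := half_pos (half_pos hδ₀pos)
  have h1 := biLoc_comp_decays (decays_trK (decays_arr hY (half_pos hδ₀pos) s))
    (biLoc_of_le (biLoc_trK hX) (half_le_self (half_pos hδ₀pos).le)) (half_pos hδ₄).le (half_lt_self hδ₄)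
  have hXY := biLoc_trK h1
  rw [← trK_comp, show trK (trK (comp (comp A V) (arr s (comp B V')))) = comp (comp A V) (arr s (comp B V')) from rfl] at hXY
  exact abs_trace_bubble₂_sub_le_of hA hB hδA hAper hBper hV hV' hδ (abs_sum_diagImages_sub_tr_le hXY (half_pos hδ₄))
    (abs_tr_comp_arr_sub_le hX hY (half_pos hδ₀pos))

end Rates

/-! ## §3 The limit along growing tori -/

section TorusLimits

variable {A B V V' : MKer D F} {p q p' q' : Site D} {CA CB δA δB Cv Cv' δ : ℝ} {σ : ℕ → ℕ} [∀ k, NeZero (σ k)]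

/-- [folklore] **TWO-LEG BUBBLE LIMIT — THE POINT OF TA3b-BUBBLE₂**: along periods `σ_k → ∞` for which BOTH legs are jointly `σ_k`-periodic (on the road:
`σ_k = n·p_k`, legs block-covariant with block `n`), `tr_{T_{σ_k}}((Â(arr V)^)(B̂(arr V′)^)) → tr ((A∘V)∘(B∘V′))` (`= PackedKernelSplit.biBubble A V B V′`, `rfl`). -/
theorem tendsto_trace_bubble₂ (hA : Decays A CA δA) (hB : Decays B CB δA) (hδA : 0 < δA)
    (hAper : ∀ k, ∀ x y t, ∀ a b : F, A (imageShift (σ k) x t) (imageShift (σ k) y t) a b = A x y a b)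
    (hBper : ∀ k, ∀ x y t, ∀ a b : F, B (imageShift (σ k) x t) (imageShift (σ k) y t) a b = B x y a b)
    (hV : BiLoc V p p' Cv δ) (hV' : BiLoc V' q' q Cv' δ) (hδ : 0 < δ) (hσ : Tendsto σ atTop atTop) :
    Tendsto (fun k => Matrix.trace (Matrix.of (periodiseF (σ k) (toF A)) * Matrix.of (periodiseF (σ k) (toF (arr (σ k) V))) *
        (Matrix.of (periodiseF (σ k) (toF B)) * Matrix.of (periodiseF (σ k) (toF (arr (σ k) V'))))))
      atTop (𝓝 (tr (comp (comp A V) (comp B V')))) :=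
  tendsto_of_abs_sub_le_imageTail₂ (D := D) hσ (half_pos (half_pos (half_pos (half_pos (lt_min hδA hδ)))))
    (half_pos (half_pos (lt_min hδA hδ))) (fun k => abs_trace_bubble₂_sub_le hA hB hδA (hAper k) (hBper k) hV hV' hδ)

/-- [folklore] The same with the two legs decaying at TWO rates `δA`, `δB` (reduced to the common rate `min δA δB` by `decays_of_le`). -/
theorem tendsto_trace_bubble₂' (hA : Decays A CA δA) (hδA : 0 < δA) (hB : Decays B CB δB) (hδB : 0 < δB)
    (hAper : ∀ k, ∀ x y t, ∀ a b : F, A (imageShift (σ k) x t) (imageShift (σ k) y t) a b = A x y a b)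
    (hBper : ∀ k, ∀ x y t, ∀ a b : F, B (imageShift (σ k) x t) (imageShift (σ k) y t) a b = B x y a b)
    (hV : BiLoc V p p' Cv δ) (hV' : BiLoc V' q' q Cv' δ) (hδ : 0 < δ) (hσ : Tendsto σ atTop atTop) :
    Tendsto (fun k => Matrix.trace (Matrix.of (periodiseF (σ k) (toF A)) * Matrix.of (periodiseF (σ k) (toF (arr (σ k) V))) *
        (Matrix.of (periodiseF (σ k) (toF B)) * Matrix.of (periodiseF (σ k) (toF (arr (σ k) V'))))))
      atTop (𝓝 (tr (comp (comp A V) (comp B V')))) :=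
  tendsto_trace_bubble₂ (decays_of_le hA (min_le_left δA δB)) (decays_of_le hB (min_le_right δA δB)) (lt_min hδA hδB) hAper hBper hV hV' hδ hσ

end TorusLimits

/-! ## §4 The identity leg: `(idK)^ = 1`, and the `V·V′` words `tr_T(Â·(arr V)^·(arr V′)^) → tr ((A∘V)∘V′)` -/

section IdentityLeg

variable [DecidableEq F]

omit [Fintype F] in
/-- [folklore] The `FKer` reading of the Kronecker kernel is the fibred Kronecker kernel. -/
theorem toF_idK : toF (idK : MKer D F) = kdeltaF := by
  funext i j
  obtain ⟨x, a⟩ := i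
  obtain ⟨y, b⟩ := j
  rw [toF_apply, idK_apply]
  simp only [kdeltaF, Prod.mk.injEq]

omit [Fintype F] in
/-- [folklore] **THE PERIODISED IDENTITY LEG IS THE TORUS IDENTITY**: `Matrix.of (periodiseF s (toF idK)) = 1`. -/
theorem periodiseF_toF_idK (s : ℕ) [NeZero s] :
    Matrix.of (periodiseF s (toF (idK : MKer D F))) = (1 : Matrix (Site D s × F) (Site D s × F) ℝ) := by
  rw [toF_idK, periodiseF_kdeltaF_matrix]

omit [Fintype F] in
/-- [folklore] The Kronecker kernel decays at every rate `δ` with constant `1` (it vanishes off the diagonal). -/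
theorem decays_idK (δ : ℝ) : Decays (idK : MKer D F) 1 δ := by
  intro x y a b
  rw [idK_apply]
  by_cases h : x = y ∧ a = b
  · rw [if_pos h, h.1, sub_self]
    have h0 : l1 (0 : Site D) = 0 := by simp [l1]
    rw [h0, mul_zero, Real.exp_zero, mul_one, abs_one]
  · rw [if_neg h, abs_zero, one_mul]
    exact (Real.exp_pos _).le

omit [Fintype F] in
/-- [folklore] The Kronecker kernel is jointly `s`-periodic. -/
theorem idK_imageShift (s : ℕ) [NeZero s] (x y t : Site D) (a b : F) :
    (idK : MKer D F) (imageShift s x t) (imageShift s y t) a b = idK x y a b := by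
  rw [idK_apply, idK_apply]
  have e : imageShift s x t = imageShift s y t ↔ x = y :=
    ⟨fun h => imageShift_left_injective s t h, fun h => by rw [h]⟩
  simp only [e]

variable {A V V' : MKer D F} {p q p' q' : Site D} {CA δA Cv Cv' δ : ℝ} {σ : ℕ → ℕ} [∀ k, NeZero (σ k)]

/-- [folklore] **THE `V·V′` WORDS**: for ONE decaying jointly-periodic leg `A` and two bi-localised vertices,
`tr_{T_{σ_k}}(Â·(arr V)^·(arr V′)^) → tr ((A∘V)∘V′)` — §3 at the identity second leg (`(idK)^ = 1`, `idK ∘ V′ = V′`). -/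
theorem tendsto_trace_arr_arr (hA : Decays A CA δA) (hδA : 0 < δA)
    (hAper : ∀ k, ∀ x y t, ∀ a b : F, A (imageShift (σ k) x t) (imageShift (σ k) y t) a b = A x y a b)
    (hV : BiLoc V p p' Cv δ) (hV' : BiLoc V' q' q Cv' δ) (hδ : 0 < δ) (hσ : Tendsto σ atTop atTop) :
    Tendsto (fun k => Matrix.trace (Matrix.of (periodiseF (σ k) (toF A)) * Matrix.of (periodiseF (σ k) (toF (arr (σ k) V))) *
        Matrix.of (periodiseF (σ k) (toF (arr (σ k) V')))))
      atTop (𝓝 (tr (comp (comp A V) V'))) := by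
  have h := tendsto_trace_bubble₂ (B := idK) hA (decays_idK δA) hδA hAper
    (fun k x y t a b => idK_imageShift (σ k) x y t a b) hV hV' hδ hσ
  rw [comp_idK_left] at h
  refine h.congr fun k => ?_
  rw [periodiseF_toF_idK, Matrix.one_mul]

end IdentityLeg

end Summit.QuantumFields.BalabanUV.Beta.D1BFx.TorusTraceBubbleTwoLeg

end
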